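import Literature.Probability.Percolation.GladkovZiminKernel
import Literature.Combinatorics.Sahi2008.Functional
import Summits.CriticalPhenomena.PercolationContinuityZ3.Theorems.PercNearOneGluingNoHeavyLowerTailLsmTwoCopy
import Mathlib.Combinatorics.SetFamily.FourFunctions
import HarnessLib

/-!
# `NoHeavyLowerTail` (stmt-CriticalPhenomena-4575) — the Gladkov–Zimin two-copy kernel inequality for EVERY weight with the FKG lattice condition

Support file (prover prim-gen-kcluster gen 46; `--supports stmt-CriticalPhenomena-4575`).  No named facts, no sorries, no definitions.

Gladkov–Zimin (draft 2024, Thm 2.1/2.3; tree `Literature.Probability.Percolation.DecisionTree.ED_ED_le_ED_diag`,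
`kernel_classMass_le`) prove, for PRODUCT measures `μ` on a finite cube and `g` cross-supermodular
(`g x t + g y z ≤ g x z + g y t` for `x ⊆ y`, `z ⊆ t`), the two-copy inequality `E_{μ⊗μ} g(S,T) ≤ E_μ g(S,S)`, whence the
kernel inequalities `Σ_{a,b} A_{ab} m_a m_b ≤ Σ_a A_{aa} m_a` for monotone labellings (Harris–Kleitman, Gladkov's strong FKG rows,
the three-point row `AG = qt − e₂(u) ≥ 0`, the `Π₃/Π₄/Π₅` certificate rows of this programme).

PRIOR ART IN THE TREE (found after this file landed): the two-copy form for log-supermodular weights is ALREADY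
`LsmTwoCopy.lsm_twoCopy_le` / `lsm_twoCopy_le_set` (prim-bnk-1 gen 14, `…LowerTailLsmTwoCopy.lean`, the same Holley-induction proof);
`sum_sum_le_mass_mul_sum_diag` and `holley_powerset` below duplicate it and are kept only because they have landed.  What this file
ADDS is the labelled form (GZ Thm 2.3: `kernel_sum_sum_le_of_latticeCondition`, `kernel_classMass_le_of_latticeCondition`) and, in the
last section, its `Set ι` / `IsFKGMeasure` versions derived from `LsmTwoCopy.lsm_twoCopy_le_set`.

THIS FILE: the product structure is not needed — **the FKG lattice condition suffices** (as Gladkov 2024 §3 remarks for the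
strong Harris–Kleitman row: measures with the FKG property are limits of monotone images of product measures ("UI"), tree
`Kahn2022.strongHarris_of_isFKGMeasure`; the same transfer gives GZ's kernel form — here instead a DIRECT proof by Holley's
inequality inside GZ's coordinate induction, with no limit argument).  For every weight `w ≥ 0` on the configurations `S ⊆ D`
with `w S · w T ≤ w (S ∩ T) · w (S ∪ T)`:
* `sum_sum_le_mass_mul_sum_diag` — `Σ_{S,T ⊆ D} w S w T g(S,T) ≤ (Σ_{S⊆D} w S) · Σ_{S ⊆ D} w S g(S,S)` (Thm 2.1 for lattice weights);
* `kernel_sum_sum_le_of_latticeCondition`, `kernel_classMass_le_of_latticeCondition` — Thm 2.3 (poset / class-mass forms).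
So the GZ kernel rows hold for every strongly positively-associated law on the edges — in particular for the random-cluster
measures `φ_{p,q}`, `q ≥ 1` (tree: `rcWeightW_lattice_condition`; for the three-point row `AG ≥ 0` this is already in the tree as
`rcMeasure_threePoint_strongHarris`, Ayyer–Linusson–Ravichandran 2025 Thm 2.10 / Gladkov 2024 Thm 3.2), with or without one-colour
external fields, and for arbitrary ferromagnetic edge interactions (KCLUSTER-gen46 §3).

PROOF (induction on `D`, as in GZ, with Holley's inequality replacing independence).  Split along `e`: `w₀ = w`, `w₁ = w(· + e)` on
`D′`; both satisfy the lattice condition and the pair satisfies Holley's condition `w₀ S · w₁ T ≤ w₀(S∩T) · w₁(S∪T)`.  With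
`X_{ij}, Y_i, m_i` the sectioned two-copy sums, diagonal sums and masses, the induction hypotheses give `X₀₀ ≤ m₀Y₀`, `X₁₁ ≤ m₁Y₁`,
and the KEY inequality `m₀m₁(X₀₁ + X₁₀) ≤ m₁²X₀₀ + m₀²X₁₁` follows from two applications of Holley's inequality (tree: Mathlib's
`Finset.four_functions_theorem`, here `holley_powerset`) to the functions `S ↦ g(S,T′) − g(S,T)` (increasing, by cross-supermodularity)
and `T ↦ Φ(T) = m₁Σ_S w₀(S)g(S,T) − m₀Σ_S w₁(S)g(S+e,T)` (decreasing); then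
`m₀m₁·Σ = m₀m₁(X₀₀+X₀₁+X₁₀+X₁₁) ≤ m₁(m₀+m₁)X₀₀ + m₀(m₀+m₁)X₁₁ ≤ m₀m₁(m₀+m₁)(Y₀+Y₁)`.
[cite: GladkovZimin2024HK, Thm. 2.1, Thm. 2.3 (product measures); Gladkov2024StrongFKG, §3 (FKG measures are UI)]; the direct Holley-induction proof is this work.
-/

namespace Summit.CriticalPhenomena.PercolationContinuityZ3.Theorems

namespace LatticeKernel

open Finset

variable {ι : Type*} [DecidableEq ι]

/-! ### Holley's inequality on a powerset algebra (from Mathlib's four functions theorem) -/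

/-- **Holley's inequality, powerset form.**  If `w₀, w₁ ≥ 0` satisfy Holley's condition `w₀ S · w₁ T ≤ w₀ (S ∩ T) · w₁ (S ∪ T)`
for `S, T ⊆ D` and `f` is increasing along `⊆` below `D`, then `(Σ w₁) · Σ w₀ f ≤ (Σ w₀) · Σ w₁ f` (sums over `S ⊆ D`):
the normalised `w₁`-average of `f` dominates the `w₀`-average.  [folklore: Holley 1974, here via Mathlib `Finset.four_functions_theorem`] -/
theorem holley_powerset (D : Finset ι) {w₀ w₁ : Finset ι → ℝ} (h0 : ∀ S, 0 ≤ w₀ S) (h1 : ∀ S, 0 ≤ w₁ S)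
    (hH : ∀ ⦃S⦄, S ⊆ D → ∀ ⦃T⦄, T ⊆ D → w₀ S * w₁ T ≤ w₀ (S ∩ T) * w₁ (S ∪ T))
    {f : Finset ι → ℝ} (hf : ∀ ⦃S T : Finset ι⦄, S ⊆ T → T ⊆ D → f S ≤ f T) :
    (∑ S ∈ D.powerset, w₁ S) * ∑ S ∈ D.powerset, w₀ S * f S ≤
      (∑ S ∈ D.powerset, w₀ S) * ∑ S ∈ D.powerset, w₁ S * f S := by
  -- shift `f` to a nonnegative increasing function `g = max (f - f ∅) 0` (equal to `f - f ∅` below `D`)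
  set g : Finset ι → ℝ := fun S => max (f S - f ∅) 0 with hg
  have hg0 : ∀ S, 0 ≤ g S := fun S => le_max_right _ _
  have hgD : ∀ ⦃S⦄, S ⊆ D → g S = f S - f ∅ := fun S hS =>
    max_eq_left (sub_nonneg.2 (hf (Finset.empty_subset S) hS))
  have hgmono : ∀ ⦃S T : Finset ι⦄, S ⊆ T → T ⊆ D → g S ≤ g T := fun S T hST hT => by
    rw [hgD (hST.trans hT), hgD hT]; linarith [hf hST hT]
  -- four functions: f₁ = w₀ g, f₂ = w₁, f₃ = w₀, f₄ = w₁ g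
  have key := Finset.four_functions_theorem D (f₁ := fun S => w₀ S * g S) (f₂ := w₁) (f₃ := w₀)
    (f₄ := fun S => w₁ S * g S)
    (fun S => mul_nonneg (h0 S) (hg0 S)) (fun S => h1 S) (fun S => h0 S) (fun S => mul_nonneg (h1 S) (hg0 S))
    (fun S hS T hT => by
      have hmono : g S ≤ g (S ∪ T) := hgmono Finset.subset_union_left (Finset.union_subset hS hT)
      calc w₀ S * g S * w₁ T = (w₀ S * w₁ T) * g S := by ring
        _ ≤ (w₀ (S ∩ T) * w₁ (S ∪ T)) * g (S ∪ T) :=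
            mul_le_mul (hH hS hT) hmono (hg0 S) (mul_nonneg (h0 _) (h1 _))
        _ = w₀ (S ∩ T) * (w₁ (S ∪ T) * g (S ∪ T)) := by ring)
    (𝒜 := D.powerset) (ℬ := D.powerset) Subset.rfl Subset.rfl
  rw [Finset.powerset_infs_powerset_self, Finset.powerset_sups_powerset_self] at key
  -- undo the shift: `Σ wᵢ g = Σ wᵢ f - f ∅ · Σ wᵢ`
  have e0 : ∑ S ∈ D.powerset, w₀ S * g S = ∑ S ∈ D.powerset, w₀ S * f S - f ∅ * ∑ S ∈ D.powerset, w₀ S := by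
    rw [Finset.mul_sum, ← Finset.sum_sub_distrib]
    exact Finset.sum_congr rfl fun S hS => by rw [hgD (Finset.mem_powerset.1 hS)]; ring
  have e1 : ∑ S ∈ D.powerset, w₁ S * g S = ∑ S ∈ D.powerset, w₁ S * f S - f ∅ * ∑ S ∈ D.powerset, w₁ S := by
    rw [Finset.mul_sum, ← Finset.sum_sub_distrib]
    exact Finset.sum_congr rfl fun S hS => by rw [hgD (Finset.mem_powerset.1 hS)]; ring
  rw [e0, e1] at key
  nlinarith [key]

/-! ### Theorem 2.1 for lattice-condition weights -/

set_option maxHeartbeats 400000 in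
/-- **Gladkov–Zimin's two-copy inequality for every FKG-lattice weight.**  Let `w ≥ 0` satisfy the lattice condition
`w S · w T ≤ w (S ∩ T) · w (S ∪ T)` for `S, T ⊆ D`, and let `g` be cross-supermodular (`g x t + g y z ≤ g x z + g y t` for
`x ⊆ y`, `z ⊆ t`).  Then `Σ_{S,T ⊆ D} w S · w T · g S T ≤ (Σ_{S⊆D} w S) · Σ_{S⊆D} w S · g S S`, i.e. for the normalised law the
two-copy average of `g` is at most its diagonal average.  (For product weights this is GZ Thm 2.1 = tree `ED_ED_le_ED_diag`.)
[this work; cite: GladkovZimin2024HK, Thm. 2.1 for the product case] -/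
theorem sum_sum_le_mass_mul_sum_diag (D : Finset ι) :
    ∀ (w : Finset ι → ℝ), (∀ S, 0 ≤ w S) →
      (∀ ⦃S⦄, S ⊆ D → ∀ ⦃T⦄, T ⊆ D → w S * w T ≤ w (S ∩ T) * w (S ∪ T)) →
      ∀ g : Finset ι → Finset ι → ℝ,
        (∀ ⦃x y z t : Finset ι⦄, x ⊆ y → z ⊆ t → g x t + g y z ≤ g x z + g y t) →
        ∑ S ∈ D.powerset, ∑ T ∈ D.powerset, w S * w T * g S T ≤
          (∑ S ∈ D.powerset, w S) * ∑ S ∈ D.powerset, w S * g S S := by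
  induction D using Finset.induction_on with
  | empty =>
    intro w _ _ g _
    simp only [Finset.powerset_empty, Finset.sum_singleton]
    nlinarith
  | @insert e D' he ih =>
    intro w hw hL g hg
    -- the two sections of the weight along `e`
    set w₁ : Finset ι → ℝ := fun S => w (insert e S) with hw₁
    have hw₁0 : ∀ S, 0 ≤ w₁ S := fun S => hw _
    have hsubD : ∀ ⦃S : Finset ι⦄, S ⊆ D' → S ⊆ insert e D' := fun S hS => hS.trans (Finset.subset_insert e D')
    have hinsD : ∀ ⦃S : Finset ι⦄, S ⊆ D' → insert e S ⊆ insert e D' := fun S hS => Finset.insert_subset_insert e hS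
    have hnot : ∀ ⦃S : Finset ι⦄, S ⊆ D' → e ∉ S := fun S hS h => he (hS h)
    -- lattice condition of `w` on `D'`, of `w₁` on `D'`, and Holley's condition for the pair `(w, w₁)`
    have hL0 : ∀ ⦃S⦄, S ⊆ D' → ∀ ⦃T⦄, T ⊆ D' → w S * w T ≤ w (S ∩ T) * w (S ∪ T) :=
      fun S hS T hT => hL (hsubD hS) (hsubD hT)
    have hL1 : ∀ ⦃S⦄, S ⊆ D' → ∀ ⦃T⦄, T ⊆ D' → w₁ S * w₁ T ≤ w₁ (S ∩ T) * w₁ (S ∪ T) := by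
      intro S hS T hT
      have h := hL (hinsD hS) (hinsD hT)
      rwa [← Finset.insert_inter_distrib, ← Finset.insert_union_distrib] at h
    have hH : ∀ ⦃S⦄, S ⊆ D' → ∀ ⦃T⦄, T ⊆ D' → w S * w₁ T ≤ w (S ∩ T) * w₁ (S ∪ T) := by
      intro S hS T hT
      have h := hL (hsubD hS) (hinsD hT)
      rwa [Finset.inter_insert_of_notMem (hnot hS), Finset.union_insert] at h
    -- names for the sectioned sums
    set m₀ : ℝ := ∑ S ∈ D'.powerset, w S with hm₀
    set m₁ : ℝ := ∑ S ∈ D'.powerset, w₁ S with hm₁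
    set X00 : ℝ := ∑ S ∈ D'.powerset, ∑ T ∈ D'.powerset, w S * w T * g S T with hX00
    set X01 : ℝ := ∑ S ∈ D'.powerset, ∑ T ∈ D'.powerset, w S * w₁ T * g S (insert e T) with hX01
    set X10 : ℝ := ∑ S ∈ D'.powerset, ∑ T ∈ D'.powerset, w₁ S * w T * g (insert e S) T with hX10
    set X11 : ℝ := ∑ S ∈ D'.powerset, ∑ T ∈ D'.powerset, w₁ S * w₁ T * g (insert e S) (insert e T) with hX11
    set Y0 : ℝ := ∑ S ∈ D'.powerset, w S * g S S with hY0
    set Y1 : ℝ := ∑ S ∈ D'.powerset, w₁ S * g (insert e S) (insert e S) with hY1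
    have hm₀ge : 0 ≤ m₀ := Finset.sum_nonneg fun S _ => hw S
    have hm₁ge : 0 ≤ m₁ := Finset.sum_nonneg fun S _ => hw₁0 S
    -- decompositions of the two sides
    have hL' : ∑ S ∈ (insert e D').powerset, ∑ T ∈ (insert e D').powerset, w S * w T * g S T =
        X00 + X01 + X10 + X11 := by
      rw [Finset.sum_powerset_insert he]
      have h1 : ∀ S, ∑ T ∈ (insert e D').powerset, w S * w T * g S T =
          (∑ T ∈ D'.powerset, w S * w T * g S T) + ∑ T ∈ D'.powerset, w S * w₁ T * g S (insert e T) :=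
        fun S => Finset.sum_powerset_insert he _
      simp only [h1, Finset.sum_add_distrib]
      ring
    have hR' : (∑ S ∈ (insert e D').powerset, w S) * ∑ S ∈ (insert e D').powerset, w S * g S S =
        (m₀ + m₁) * (Y0 + Y1) := by
      rw [Finset.sum_powerset_insert he, Finset.sum_powerset_insert he]
    -- induction hypotheses
    have hI0 : X00 ≤ m₀ * Y0 := ih w hw hL0 g hg
    have hI1 : X11 ≤ m₁ * Y1 := by
      refine ih w₁ hw₁0 hL1 (fun S T => g (insert e S) (insert e T)) ?_
      intro x y z t hxy hzt
      exact hg (Finset.insert_subset_insert e hxy) (Finset.insert_subset_insert e hzt)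
    -- the KEY inequality `m₀ m₁ (X01 + X10) ≤ m₁² X00 + m₀² X11` by two Holley steps
    set Φ : Finset ι → ℝ := fun T =>
      m₁ * ∑ S ∈ D'.powerset, w S * g S T - m₀ * ∑ S ∈ D'.powerset, w₁ S * g (insert e S) T with hΦ
    -- (K1) `Φ` is antitone along `⊆` (no restriction to `D'` needed on the second argument)
    have hK1 : ∀ ⦃T T' : Finset ι⦄, T ⊆ T' → Φ T' ≤ Φ T := by
      intro T T' hTT'
      -- `R S = g S T' - g S T` is increasing in `S`
      have hR : ∀ ⦃S S' : Finset ι⦄, S ⊆ S' → S' ⊆ D' → g S T' - g S T ≤ g S' T' - g S' T := by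
        intro S S' hSS' _
        have := hg hSS' hTT'
        linarith
      have hR' : ∀ ⦃S S' : Finset ι⦄, S ⊆ S' → g S T' - g S T ≤ g S' T' - g S' T := by
        intro S S' hSS'
        have := hg hSS' hTT'
        linarith
      -- Holley: `m₁ Σ w R ≤ m₀ Σ w₁ R`
      have hHol := holley_powerset D' hw hw₁0 hH (f := fun S => g S T' - g S T) hR
      -- pointwise: `Σ w₁ S R S ≤ Σ w₁ S R (S + e)`
      have hpt : ∑ S ∈ D'.powerset, w₁ S * (g S T' - g S T) ≤
          ∑ S ∈ D'.powerset, w₁ S * (g (insert e S) T' - g (insert e S) T) :=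
        Finset.sum_le_sum fun S _ => mul_le_mul_of_nonneg_left (hR' (Finset.subset_insert e S)) (hw₁0 S)
      have A1 : ∑ S ∈ D'.powerset, w S * (g S T' - g S T) =
          ∑ S ∈ D'.powerset, w S * g S T' - ∑ S ∈ D'.powerset, w S * g S T := by
        rw [← Finset.sum_sub_distrib]; exact Finset.sum_congr rfl fun S _ => by ring
      have A2 : ∑ S ∈ D'.powerset, w₁ S * (g (insert e S) T' - g (insert e S) T) =
          ∑ S ∈ D'.powerset, w₁ S * g (insert e S) T' - ∑ S ∈ D'.powerset, w₁ S * g (insert e S) T := by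
        rw [← Finset.sum_sub_distrib]; exact Finset.sum_congr rfl fun S _ => by ring
      have e1 : Φ T' - Φ T = m₁ * ∑ S ∈ D'.powerset, w S * (g S T' - g S T) -
          m₀ * ∑ S ∈ D'.powerset, w₁ S * (g (insert e S) T' - g (insert e S) T) := by
        rw [A1, A2]; simp only [hΦ]; ring
      have h2 : m₀ * ∑ S ∈ D'.powerset, w₁ S * (g S T' - g S T) ≤
          m₀ * ∑ S ∈ D'.powerset, w₁ S * (g (insert e S) T' - g (insert e S) T) :=
        mul_le_mul_of_nonneg_left hpt hm₀ge
      linarith [hHol, h2, e1]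
    -- (K2) Holley for the antitone `Φ`: `m₀ Σ w₁ Φ ≤ m₁ Σ w Φ`
    have hK2 : m₀ * ∑ T ∈ D'.powerset, w₁ T * Φ T ≤ m₁ * ∑ T ∈ D'.powerset, w T * Φ T := by
      have h := holley_powerset D' hw hw₁0 hH (f := fun T => -Φ T) (fun S T hST _ => neg_le_neg (hK1 hST))
      have e0 : ∑ S ∈ D'.powerset, w S * -Φ S = -∑ S ∈ D'.powerset, w S * Φ S := by
        rw [← Finset.sum_neg_distrib]; exact Finset.sum_congr rfl fun S _ => by ring
      have e1 : ∑ S ∈ D'.powerset, w₁ S * -Φ S = -∑ S ∈ D'.powerset, w₁ S * Φ S := by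
        rw [← Finset.sum_neg_distrib]; exact Finset.sum_congr rfl fun S _ => by ring
      rw [e0, e1] at h
      linarith
    -- (K3) pointwise: `Σ w₁ T Φ (T + e) ≤ Σ w₁ T Φ T`
    have hK3 : ∑ T ∈ D'.powerset, w₁ T * Φ (insert e T) ≤ ∑ T ∈ D'.powerset, w₁ T * Φ T :=
      Finset.sum_le_sum fun T _ => mul_le_mul_of_nonneg_left (hK1 (Finset.subset_insert e T)) (hw₁0 T)
    -- the sums of `w Φ` and `w₁ Φ(· + e)` in terms of the `X`'s
    have c00 : ∑ T ∈ D'.powerset, ∑ S ∈ D'.powerset, w S * w T * g S T = X00 := by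
      rw [hX00]; exact Finset.sum_comm
    have c10 : ∑ T ∈ D'.powerset, ∑ S ∈ D'.powerset, w₁ S * w T * g (insert e S) T = X10 := by
      rw [hX10]; exact Finset.sum_comm
    have c01 : ∑ T ∈ D'.powerset, ∑ S ∈ D'.powerset, w S * w₁ T * g S (insert e T) = X01 := by
      rw [hX01]; exact Finset.sum_comm
    have c11 : ∑ T ∈ D'.powerset, ∑ S ∈ D'.powerset, w₁ S * w₁ T * g (insert e S) (insert e T) = X11 := by
      rw [hX11]; exact Finset.sum_comm
    have eΦ0 : ∑ T ∈ D'.powerset, w T * Φ T = m₁ * X00 - m₀ * X10 := by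
      have hT : ∀ T, w T * Φ T = m₁ * (∑ S ∈ D'.powerset, w S * w T * g S T) -
          m₀ * (∑ S ∈ D'.powerset, w₁ S * w T * g (insert e S) T) := by
        intro T
        have a1 : ∑ S ∈ D'.powerset, w S * w T * g S T = w T * ∑ S ∈ D'.powerset, w S * g S T := by
          rw [Finset.mul_sum]; exact Finset.sum_congr rfl fun S _ => by ring
        have a2 : ∑ S ∈ D'.powerset, w₁ S * w T * g (insert e S) T = w T * ∑ S ∈ D'.powerset, w₁ S * g (insert e S) T := by
          rw [Finset.mul_sum]; exact Finset.sum_congr rfl fun S _ => by ring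
        rw [a1, a2]; simp only [hΦ]; ring
      rw [Finset.sum_congr rfl fun T _ => hT T, Finset.sum_sub_distrib, ← Finset.mul_sum, ← Finset.mul_sum, c00, c10]
    have eΦ1 : ∑ T ∈ D'.powerset, w₁ T * Φ (insert e T) = m₁ * X01 - m₀ * X11 := by
      have hT : ∀ T, w₁ T * Φ (insert e T) = m₁ * (∑ S ∈ D'.powerset, w S * w₁ T * g S (insert e T)) -
          m₀ * (∑ S ∈ D'.powerset, w₁ S * w₁ T * g (insert e S) (insert e T)) := by
        intro T
        have a1 : ∑ S ∈ D'.powerset, w S * w₁ T * g S (insert e T) = w₁ T * ∑ S ∈ D'.powerset, w S * g S (insert e T) := by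
          rw [Finset.mul_sum]; exact Finset.sum_congr rfl fun S _ => by ring
        have a2 : ∑ S ∈ D'.powerset, w₁ S * w₁ T * g (insert e S) (insert e T) =
            w₁ T * ∑ S ∈ D'.powerset, w₁ S * g (insert e S) (insert e T) := by
          rw [Finset.mul_sum]; exact Finset.sum_congr rfl fun S _ => by ring
        rw [a1, a2]; simp only [hΦ]; ring
      rw [Finset.sum_congr rfl fun T _ => hT T, Finset.sum_sub_distrib, ← Finset.mul_sum, ← Finset.mul_sum, c01, c11]
    have hKEY : m₀ * m₁ * (X01 + X10) ≤ m₁ * m₁ * X00 + m₀ * m₀ * X11 := by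
      have h1 : m₀ * ∑ T ∈ D'.powerset, w₁ T * Φ (insert e T) ≤ m₁ * ∑ T ∈ D'.powerset, w T * Φ T :=
        (mul_le_mul_of_nonneg_left hK3 hm₀ge).trans hK2
      rw [eΦ0, eΦ1] at h1
      nlinarith [h1]
    -- vanishing of a section with zero mass
    have hzero : ∀ {v : Finset ι → ℝ}, (∀ S, 0 ≤ v S) → ∑ S ∈ D'.powerset, v S = 0 →
        ∀ S ∈ D'.powerset, v S = 0 := fun hv hs =>
      (Finset.sum_eq_zero_iff_of_nonneg fun S _ => hv S).1 hs
    rw [hL', hR']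
    rcases eq_or_lt_of_le hm₀ge with hm0 | hm0
    · -- `m₀ = 0`: the `w`-section vanishes
      have hv := hzero hw hm0.symm
      have x00 : X00 = 0 := Finset.sum_eq_zero fun S hS => Finset.sum_eq_zero fun T _ => by rw [hv S hS]; ring
      have x01 : X01 = 0 := Finset.sum_eq_zero fun S hS => Finset.sum_eq_zero fun T _ => by rw [hv S hS]; ring
      have x10 : X10 = 0 := Finset.sum_eq_zero fun S _ => Finset.sum_eq_zero fun T hT => by rw [hv T hT]; ring
      have y0 : Y0 = 0 := Finset.sum_eq_zero fun S hS => by rw [hv S hS]; ring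
      rw [x00, x01, x10, y0, ← hm0]
      linarith
    rcases eq_or_lt_of_le hm₁ge with hm1 | hm1
    · -- `m₁ = 0`: the `w₁`-section vanishes
      have hv := hzero hw₁0 hm1.symm
      have x11 : X11 = 0 := Finset.sum_eq_zero fun S hS => Finset.sum_eq_zero fun T _ => by rw [hv S hS]; ring
      have x01 : X01 = 0 := Finset.sum_eq_zero fun S _ => Finset.sum_eq_zero fun T hT => by rw [hv T hT]; ring
      have x10 : X10 = 0 := Finset.sum_eq_zero fun S hS => Finset.sum_eq_zero fun T _ => by rw [hv S hS]; ring
      have y1 : Y1 = 0 := Finset.sum_eq_zero fun S hS => by rw [hv S hS]; ring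
      rw [x11, x01, x10, y1, ← hm1]
      linarith
    -- generic case: multiply by `m₀ m₁ > 0`
    have hprod : 0 < m₀ * m₁ := mul_pos hm0 hm1
    have h3 : m₀ * m₁ * (X00 + X01 + X10 + X11) ≤ m₀ * m₁ * ((m₀ + m₁) * (Y0 + Y1)) := by
      have a1 : m₁ * (m₀ + m₁) * X00 ≤ m₁ * (m₀ + m₁) * (m₀ * Y0) :=
        mul_le_mul_of_nonneg_left hI0 (mul_nonneg hm₁ge (add_nonneg hm₀ge hm₁ge))
      have a2 : m₀ * (m₀ + m₁) * X11 ≤ m₀ * (m₀ + m₁) * (m₁ * Y1) :=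
        mul_le_mul_of_nonneg_left hI1 (mul_nonneg hm₀ge (add_nonneg hm₀ge hm₁ge))
      nlinarith [hKEY, a1, a2]
    exact le_of_mul_le_mul_left h3 hprod

/-! ### Theorem 2.3 (poset and class-mass forms) for lattice-condition weights -/

/-- **Kernel inequality along a monotone labelling, for FKG-lattice weights** (GZ Thm 2.3, poset form, with the product
measure replaced by any `w ≥ 0` with `w S · w T ≤ w (S ∩ T) · w (S ∪ T)`): for `π` monotone along `⊆` into a preorder and a
kernel `A` with `A a d + A b c ≤ A a c + A b d` for `a ≤ b`, `c ≤ d`,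
`Σ_{S,T⊆D} w S w T · A (π S) (π T) ≤ (Σ w) · Σ_S w S · A (π S) (π S)`. [this work; cite: GladkovZimin2024HK, Thm. 2.3] -/
theorem kernel_sum_sum_le_of_latticeCondition (D : Finset ι) {w : Finset ι → ℝ} (hw : ∀ S, 0 ≤ w S)
    (hL : ∀ ⦃S⦄, S ⊆ D → ∀ ⦃T⦄, T ⊆ D → w S * w T ≤ w (S ∩ T) * w (S ∪ T))
    {κ : Type*} [Preorder κ] (π : Finset ι → κ) (hπ : ∀ ⦃x y : Finset ι⦄, x ⊆ y → π x ≤ π y) (A : κ → κ → ℝ)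
    (hA : ∀ ⦃a b c d : κ⦄, a ≤ b → c ≤ d → A a d + A b c ≤ A a c + A b d) :
    ∑ S ∈ D.powerset, ∑ T ∈ D.powerset, w S * w T * A (π S) (π T) ≤
      (∑ S ∈ D.powerset, w S) * ∑ S ∈ D.powerset, w S * A (π S) (π S) :=
  sum_sum_le_mass_mul_sum_diag D w hw hL (fun S T => A (π S) (π T)) fun _ _ _ _ hxy hzt => hA (hπ hxy) (hπ hzt)

/-- **Class-mass form** (GZ Thm 2.3 as printed, for FKG-lattice weights): with `m_a = Σ_{S ⊆ D, π S = a} w S` the class masses of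
a monotone labelling and `A` a GZ kernel, `Σ_{a,b ∈ t} A a b · m_a m_b ≤ (Σ_{a∈t} m_a) · Σ_{a ∈ t} A a a · m_a` for every finite `t`
containing all labels.  (For a probability weight `Σ m_a = 1`.)  Instances: Harris/FKG (`A a b = f₁ a f₂ b`), Gladkov's strong FKG
rows and the three-point row `AG = qt − e₂(u) ≥ 0` on the partition lattice of three terminals — hence all of these hold for every
edge law with the FKG lattice condition (random-cluster measures with `q ≥ 1`, ferromagnetic edge interactions).
[this work; cite: GladkovZimin2024HK, Thm. 2.3] -/
theorem kernel_classMass_le_of_latticeCondition (D : Finset ι) {w : Finset ι → ℝ} (hw : ∀ S, 0 ≤ w S)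
    (hL : ∀ ⦃S⦄, S ⊆ D → ∀ ⦃T⦄, T ⊆ D → w S * w T ≤ w (S ∩ T) * w (S ∪ T))
    {κ : Type*} [Preorder κ] [DecidableEq κ] (π : Finset ι → κ) (hπ : ∀ ⦃x y : Finset ι⦄, x ⊆ y → π x ≤ π y)
    (t : Finset κ) (ht : ∀ S ∈ D.powerset, π S ∈ t)
    (A : κ → κ → ℝ) (hA : ∀ ⦃a b c d : κ⦄, a ≤ b → c ≤ d → A a d + A b c ≤ A a c + A b d) :
    ∑ a ∈ t, ∑ b ∈ t, A a b * ((∑ S ∈ D.powerset with π S = a, w S) * ∑ S ∈ D.powerset with π S = b, w S) ≤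
      (∑ a ∈ t, ∑ S ∈ D.powerset with π S = a, w S) * ∑ a ∈ t, A a a * ∑ S ∈ D.powerset with π S = a, w S := by
  have h := kernel_sum_sum_le_of_latticeCondition D hw hL π hπ A hA
  -- fibrewise rewriting `Σ_S w S φ(π S) = Σ_a φ a · m_a`
  have fib : ∀ φ : κ → ℝ, ∑ S ∈ D.powerset, w S * φ (π S) = ∑ a ∈ t, φ a * ∑ S ∈ D.powerset with π S = a, w S := by
    intro φ
    rw [← Finset.sum_fiberwise_of_maps_to ht]
    refine Finset.sum_congr rfl fun a _ => ?_
    rw [Finset.mul_sum]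
    refine Finset.sum_congr rfl fun S hS => ?_
    rw [(Finset.mem_filter.1 hS).2, mul_comm]
  have hmass : ∑ S ∈ D.powerset, w S = ∑ a ∈ t, ∑ S ∈ D.powerset with π S = a, w S := by
    have := fib (fun _ => 1)
    simp only [mul_one, one_mul] at this
    exact this
  rw [fib (fun a => A a a), hmass] at h
  have hinner : ∀ S ∈ D.powerset, ∑ T ∈ D.powerset, w S * w T * A (π S) (π T) =
      w S * ∑ b ∈ t, A (π S) b * ∑ T ∈ D.powerset with π T = b, w T := by
    intro S _
    rw [← fib (fun b => A (π S) b), Finset.mul_sum]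
    exact Finset.sum_congr rfl fun T _ => by ring
  rw [Finset.sum_congr rfl hinner, fib (fun a => ∑ b ∈ t, A a b * ∑ T ∈ D.powerset with π T = b, w T)] at h
  have hre : ∀ a ∈ t, ∑ b ∈ t, A a b * ((∑ S ∈ D.powerset with π S = a, w S) * ∑ S ∈ D.powerset with π S = b, w S) =
      (∑ b ∈ t, A a b * ∑ T ∈ D.powerset with π T = b, w T) * ∑ S ∈ D.powerset with π S = a, w S := by
    intro a _
    rw [Finset.sum_mul]
    exact Finset.sum_congr rfl fun b _ => by ring
  rw [Finset.sum_congr rfl hre]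
  exact h

/-! ### `Set ι` and `IsFKGMeasure` versions (from the tree's `LsmTwoCopy.lsm_twoCopy_le_set`) -/

section SetVersions

variable [Fintype ι]

/-- **Labelled kernel inequality for log-supermodular weights on `Set ι`** (GZ Thm 2.3, poset form): for `μ ≥ 0` on `Set ι` with
`μ s · μ t ≤ μ (s ∩ t) · μ (s ∪ t)`, a labelling `π` monotone along `⊆` into a preorder and a GZ kernel `A`
(`A a d + A b c ≤ A a c + A b d` for `a ≤ b`, `c ≤ d`):
`Σ_{ω,ω′} μ ω μ ω′ A (π ω) (π ω′) ≤ (Σ μ) · Σ_ω μ ω A (π ω) (π ω)`.  One line from `LsmTwoCopy.lsm_twoCopy_le_set`.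
[this work; cite: GladkovZimin2024HK, Thm. 2.3] -/
theorem kernel_sum_sum_le_set_of_latticeCondition (μ : Set ι → ℝ) (hμ0 : ∀ s, 0 ≤ μ s)
    (hμ : ∀ s t, μ s * μ t ≤ μ (s ∩ t) * μ (s ∪ t)) {κ : Type*} [Preorder κ] (π : Set ι → κ)
    (hπ : ∀ ⦃x y : Set ι⦄, x ⊆ y → π x ≤ π y) (A : κ → κ → ℝ)
    (hA : ∀ ⦃a b c d : κ⦄, a ≤ b → c ≤ d → A a d + A b c ≤ A a c + A b d) :
    ∑ ω : Set ι, ∑ ω' : Set ι, μ ω * μ ω' * A (π ω) (π ω') ≤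
      (∑ ω : Set ι, μ ω) * ∑ ω : Set ι, μ ω * A (π ω) (π ω) :=
  LsmTwoCopy.lsm_twoCopy_le_set μ hμ0 hμ (fun s t => A (π s) (π t))
    fun _ _ _ _ hxy hzt => hA (hπ hxy) (hπ hzt)

open Literature.Combinatorics.Sahi2008 in
/-- **GZ Thm 2.3 (class masses) for every FKG probability weight** (`IsFKGMeasure` on the lattice `Set ι`): with
`m_a = Σ_{ω : π ω = a} μ ω` the class masses of a monotone labelling `π` and `A` a GZ kernel,
`Σ_{a,b ∈ t} A a b · m_a m_b ≤ Σ_{a ∈ t} A a a · m_a` for every finite `t` containing all labels.  Instances: Harris/FKG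
(`A a b = f₁ a f₂ b`), Gladkov's strong-FKG / sunflower rows, the three-point row `AG ≥ 0` and the `Π₃/Π₄/Π₅` kernel rows of this
programme — for every edge law with the FKG lattice condition (random-cluster `q ≥ 1`, tree `isFKGMeasure_rcMeasure`).
[this work; cite: GladkovZimin2024HK, Thm. 2.3; Gladkov2024StrongFKG, §3] -/
theorem kernel_classMass_le_of_isFKGMeasure {μ : Set ι → ℝ} (hμ : IsFKGMeasure μ) {κ : Type*} [Preorder κ]
    [DecidableEq κ] (π : Set ι → κ) (hπ : ∀ ⦃x y : Set ι⦄, x ⊆ y → π x ≤ π y) (t : Finset κ) (ht : ∀ ω, π ω ∈ t)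
    (A : κ → κ → ℝ) (hA : ∀ ⦃a b c d : κ⦄, a ≤ b → c ≤ d → A a d + A b c ≤ A a c + A b d) :
    ∑ a ∈ t, ∑ b ∈ t, A a b * ((∑ ω : Set ι with π ω = a, μ ω) * ∑ ω : Set ι with π ω = b, μ ω) ≤
      ∑ a ∈ t, A a a * ∑ ω : Set ι with π ω = a, μ ω := by
  have h := kernel_sum_sum_le_set_of_latticeCondition μ hμ.nonneg (fun s t => hμ.mul_le_mul s t) π hπ A hA
  rw [hμ.sum_eq_one, one_mul] at h
  -- fibrewise rewriting `Σ_ω μ ω φ(π ω) = Σ_a φ a · m_a`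
  have fib : ∀ φ : κ → ℝ, ∑ ω : Set ι, μ ω * φ (π ω) = ∑ a ∈ t, φ a * ∑ ω : Set ι with π ω = a, μ ω := by
    intro φ
    rw [← Finset.sum_fiberwise_of_maps_to (s := Finset.univ) (t := t) (g := π) fun ω _ => ht ω]
    refine Finset.sum_congr rfl fun a _ => ?_
    rw [Finset.mul_sum]
    refine Finset.sum_congr rfl fun ω hω => ?_
    rw [(Finset.mem_filter.1 hω).2, mul_comm]
  rw [fib (fun a => A a a)] at h
  have hinner : ∀ ω : Set ι, ∑ ω' : Set ι, μ ω * μ ω' * A (π ω) (π ω') =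
      μ ω * ∑ b ∈ t, A (π ω) b * ∑ ω' : Set ι with π ω' = b, μ ω' := by
    intro ω
    rw [← fib (fun b => A (π ω) b), Finset.mul_sum]
    exact Finset.sum_congr rfl fun ω' _ => by ring
  rw [Fintype.sum_congr _ _ hinner, fib (fun a => ∑ b ∈ t, A a b * ∑ ω' : Set ι with π ω' = b, μ ω')] at h
  have hre : ∀ a ∈ t, ∑ b ∈ t, A a b * ((∑ ω : Set ι with π ω = a, μ ω) * ∑ ω : Set ι with π ω = b, μ ω) =
      (∑ b ∈ t, A a b * ∑ ω' : Set ι with π ω' = b, μ ω') * ∑ ω : Set ι with π ω = a, μ ω := by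
    intro a _
    rw [Finset.sum_mul]
    exact Finset.sum_congr rfl fun b _ => by ring
  rw [Finset.sum_congr rfl hre]
  exact h

end SetVersions

end LatticeKernel

end Summit.CriticalPhenomena.PercolationContinuityZ3.Theorems
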